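/-
Copyright (c) 2026. All rights reserved.
Released under Apache 2.0 license as described in the file LICENSE.
Authors: abc-iut cell, IUT REPAIR / RESCUE-H prover seat abc-iut-rp-d4 (gen 3).
-/
import Literature.IUT.LogVolume.UnitLogValuationProfileBoundaryBall
import Literature.IUT.LogVolume.UnitLogInnerRadiusTieRoots
import HarnessLib

/-!
# The VALUATION PROFILE of `log_p(𝒪_K^×)`, V: what the first-order hypothesis (NZ) means —
# `(NZ) ⟺ K has no non-trivial p-th root of unity` (at `(p−1) ∣ e`, `p ∤ e/(p−1)`), and (NZ) is automatic when `(p−1) ∤ e`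

PROOF-ONLY appendix (no `def`, no named fact) to `UnitLogValuationProfile{NoZeta,BoundaryBall}.lean` (abc-iut-rp-d4; D-0079 RESCUE-H row
«valuation profile with/without ζ_p»).  Parts III–IV are stated under **(NZ) `∀ X : K, ‖p‖ ≤ ‖X^{p−1} + p‖`** («`−p` is not a
`(p−1)`-th power to first order»), a hypothesis chosen because it is exactly what the non-cancellation of tying terms needs and because it
is first-order in the norm.  This file pins its meaning BY NAME, so that the RESCUE-H table's column `zeta_p ∈ {absent, present, unknown}`
reads the (NZ)-theorems correctly:

* `noZeta_of_not_dvd` — `(p−1) ∤ e` ⟹ (NZ) (a first-order `(p−1)`-th root of `−p` would have `(p−1)·ord = e`): parts I–II are the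
  special case of parts III–IV.
* `not_noZeta_of_pow_prime_eq_one` — a non-trivial `p`-th root of unity violates (NZ) (`p` odd, `e = A·(p−1)`, `p ∤ A`), through
  abc-iut-c312-3's unit zero `(ζ − 1)/ϖ^A` of the residue polynomial (`LogEnvelope.exists_unit_zero_of_pow_prime_eq_one`, p-17:47) and
  part IV's `norm_lt_one_of_norm_addPoly_lt_one`.
* `noZeta_of_forall_pow_prime_eq_one` — conversely NO non-trivial `p`-th root of unity ⟹ (NZ) (same hypotheses): a first-order root `X`
  of `X^{p−1} = −p` has level `A` and `a := X/ϖ^A` is a unit zero, which abc-iut-c312-3's LIFT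
  (`LogEnvelope.exists_pow_prime_eq_one_of_unit_zero`) turns into a `ζ_p`.
* `noZeta_iff_forall_pow_prime_eq_one` — the equivalence; hence part IV's boundary ball and abc-iut-c312-3's
  `LogEnvelope.closedBall_level_subset_logUnits_of_forall_pow_prime_eq_one` are the SAME theorem under `p ∤ A` (two independent landings,
  17:47Z / 17:53Z), while parts III–IV also cover `p ∣ A` (several tie levels) under (NZ).

Classical (`ℚ_p(ζ_p) = ℚ_p((−p)^{1/(p−1)})`; Washington Lemma 1.4 / §5.1; Neukirch ANT II (5.7), (7.13)); nothing disputed; no IUT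
statement asserted; no side taken on [IUTchIII] Cor. 3.12 or on any author.
References: [cite: Washington1997, Lemma 1.4, §5.1] [cite: NeukirchANT1999, Ch. II Prop. (5.7), (7.13)].
-/

noncomputable section

open Metric Set IsUltrametricDist
open scoped NormedField

namespace Literature.IUT.LogVolume

namespace ValuationProfile

open Literature.NumberTheory.GaloisRepresentations.Ultrametric Literature.NumberTheory.Transcendental RamificationCriterion

variable (p : ℕ) [hp : Fact p.Prime]
variable {K : Type*} [NontriviallyNormedField K] [instK : NormedAlgebra ℚ_[p] K] [IsUltrametricDist K]
  [ProperSpace K]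

omit hp instK [ProperSpace K] in
/-- **A failure of (NZ) sits at level `e/(p−1)`**: if `‖X^{p−1} + p‖ < ‖p‖` then `X ≠ 0` and `‖X‖^{p−1} = ‖p‖` (isosceles principle).
[cite: NeukirchANT1999, Ch. II Prop. (5.7)] -/
theorem norm_pow_eq_of_lt {X : K} (hX : ‖X ^ (p - 1) + (p : K)‖ < ‖(p : K)‖) : ‖X‖ ^ (p - 1) = ‖(p : K)‖ := by
  rw [← norm_pow]
  by_contra hne
  have h := IsUltrametricDist.norm_add_eq_max_of_norm_ne_norm hne
  rw [h] at hX
  exact absurd (le_max_right _ _) (not_le.mpr hX)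

/-- **`(p−1) ∤ e` ⟹ (NZ)**: a first-order `(p−1)`-th root `X` of `−p` would have `‖X‖ = ‖ϖ‖ᵏ` with `k·(p−1) = e`.  So parts I–II of
the profile are the special case `(p−1) ∤ e` of parts III–IV. [cite: NeukirchANT1999, Ch. II Prop. (5.7)] -/
theorem noZeta_of_not_dvd (hnd : ¬ (p - 1) ∣ absRamificationIdx p K) : ∀ X : K, ‖(p : K)‖ ≤ ‖X ^ (p - 1) + (p : K)‖ := by
  classical
  intro X
  by_contra hlt
  rw [not_le] at hlt
  obtain ⟨ϖ, hϖ⟩ := exists_isUniformizer (F := K)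
  have hρ0 : 0 < ‖(ϖ : K)‖ := norm_units_pos ϖ
  have hpow := norm_pow_eq_of_lt p hlt
  have hX0 : X ≠ 0 := by
    intro h0
    have hp0 : (0 : ℝ) < (p : ℝ)⁻¹ := by
      have : (0 : ℝ) < p := by exact_mod_cast hp.out.pos
      positivity
    rw [h0, norm_zero, zero_pow (by have := hp.out.two_le; omega), norm_prime p K] at hpow
    linarith
  obtain ⟨k, hk⟩ := hϖ.2 (Units.mk0 X hX0)
  rw [Units.val_mk0] at hk
  rw [hk, norm_prime_eq_norm_pow p K hϖ, ← zpow_natCast, ← zpow_mul, ← zpow_natCast] at hpow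
  have hexp : k * ((p - 1 : ℕ) : ℤ) = (absRamificationIdx p K : ℤ) := zpow_right_injective₀ hρ0 hϖ.1.ne hpow
  apply hnd
  have h1 : ((p - 1 : ℕ) : ℤ) ∣ (absRamificationIdx p K : ℤ) := ⟨k, by rw [← hexp, mul_comm]⟩
  exact Int.natCast_dvd_natCast.mp h1

/-- **A non-trivial `p`-th root of unity violates (NZ)** (`p` odd, `e = A·(p−1)`, `p ∤ A`): abc-iut-c312-3's unit zero `a = (ζ−1)/ϖ^A` of
`ā ↦ ā + c̄·ā^p` (`LogEnvelope.exists_unit_zero_of_pow_prime_eq_one`) contradicts part IV's `norm_lt_one_of_norm_addPoly_lt_one` under (NZ).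
[cite: Washington1997, Lemma 1.4, §5.1] -/
theorem not_noZeta_of_pow_prime_eq_one (hp2 : p ≠ 2) {ϖ : Kˣ} (hϖ : IsUniformizer ϖ) {A : ℕ}
    (hA : absRamificationIdx p K = A * (p - 1)) (hpA : ¬ p ∣ A) {ζ : K} (hζ : ζ ^ p = 1) (hζ1 : ζ ≠ 1) :
    ¬ ∀ X : K, ‖(p : K)‖ ≤ ‖X ^ (p - 1) + (p : K)‖ := by
  intro hNZ
  obtain ⟨a, ha1, -, hΛ⟩ := LogEnvelope.exists_unit_zero_of_pow_prime_eq_one p hϖ hA hp2 hpA hζ hζ1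
  rw [hA] at hΛ
  exact absurd ha1 (ne_of_lt (norm_lt_one_of_norm_addPoly_lt_one p hNZ ha1.le hΛ))

/-- **No non-trivial `p`-th root of unity ⟹ (NZ)** (`p` odd, `e = A·(p−1)`, `p ∤ A`): a first-order root `X` of `X^{p−1} = −p` has
`‖X‖ = ‖ϖ‖^A`, and `a := X/ϖ^A` is a UNIT zero of the residue polynomial (`c·a^{p−1} = X^{p−1}/p`), which abc-iut-c312-3's LIFT
`LogEnvelope.exists_pow_prime_eq_one_of_unit_zero` turns into a non-trivial `ζ_p`. [cite: Washington1997, Lemma 1.4, §5.1] -/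
theorem noZeta_of_forall_pow_prime_eq_one (hp2 : p ≠ 2) {ϖ : Kˣ} (hϖ : IsUniformizer ϖ) {A : ℕ}
    (hA : absRamificationIdx p K = A * (p - 1)) (hpA : ¬ p ∣ A) (hμ : ∀ ζ : K, ζ ^ p = 1 → ζ = 1) :
    ∀ X : K, ‖(p : K)‖ ≤ ‖X ^ (p - 1) + (p : K)‖ := by
  haveI := IwasawaLog.charZero p (F := K)
  intro X
  by_contra hlt
  rw [not_le] at hlt
  have hρ0 : 0 < ‖(ϖ : K)‖ := norm_units_pos ϖ
  have hp0 : (p : K) ≠ 0 := by exact_mod_cast hp.out.ne_zero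
  have hpn : 0 < ‖(p : K)‖ := norm_pos_iff.mpr hp0
  have hp1 : 1 ≤ p := hp.out.one_le
  have hϖA0 : (ϖ : K) ^ A ≠ 0 := pow_ne_zero _ ϖ.ne_zero
  -- `‖X‖ = ‖ϖ‖^A`
  have hpow := norm_pow_eq_of_lt p hlt
  rw [norm_prime_eq_norm_pow p K hϖ, hA, pow_mul] at hpow
  have hXn : ‖X‖ = ‖(ϖ : K)‖ ^ A :=
    (pow_left_inj₀ (norm_nonneg X) (by positivity) (by have := hp.out.two_le; omega : p - 1 ≠ 0)).mp hpow
  -- the unit `a := X/ϖ^A`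
  set a : K := X / (ϖ : K) ^ A with hadef
  have ha1 : ‖a‖ = 1 := by rw [hadef, norm_div, norm_pow, hXn, div_self (by positivity)]
  have hXa : X = (ϖ : K) ^ A * a := by rw [hadef, mul_div_cancel₀ _ hϖA0]
  -- `a + c·a^p = a·(X^{p−1} + p)/p`, of norm `< 1`
  have hap : a ^ p = a ^ (p - 1) * a := by rw [← pow_succ, Nat.sub_add_cancel hp1]
  have hid : a + (ϖ : K) ^ absRamificationIdx p K / (p : K) * a ^ p = a * ((X ^ (p - 1) + (p : K)) / (p : K)) := by
    rw [hA, hap, hXa, mul_pow, ← pow_mul, mul_comm A (p - 1)]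
    field_simp
    ring
  have hΛ : ‖a + (ϖ : K) ^ absRamificationIdx p K / (p : K) * a ^ p‖ < 1 := by
    rw [hid, norm_mul, ha1, one_mul, norm_div, div_lt_one hpn]
    exact hlt
  obtain ⟨ζ, hζ, hζ1⟩ := LogEnvelope.exists_pow_prime_eq_one_of_unit_zero p hϖ hA hp2 hpA ha1 hΛ
  exact hζ1 (hμ ζ hζ)

/-- **(NZ) ⟺ «no non-trivial `p`-th root of unity»** for `p` odd, `e = A·(p−1)`, `p ∤ A`.  Consequently part IV's boundary ball and
abc-iut-c312-3's `LogEnvelope.closedBall_level_subset_logUnits_of_forall_pow_prime_eq_one` coincide there, and the RESCUE-H column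
`zeta_p = absent` may be read as (NZ). [cite: Washington1997, Lemma 1.4, §5.1] [cite: NeukirchANT1999, Ch. II Prop. (5.7), (7.13)] -/
theorem noZeta_iff_forall_pow_prime_eq_one (hp2 : p ≠ 2) {ϖ : Kˣ} (hϖ : IsUniformizer ϖ) {A : ℕ}
    (hA : absRamificationIdx p K = A * (p - 1)) (hpA : ¬ p ∣ A) :
    (∀ X : K, ‖(p : K)‖ ≤ ‖X ^ (p - 1) + (p : K)‖) ↔ ∀ ζ : K, ζ ^ p = 1 → ζ = 1 :=
  ⟨fun hNZ _ hζ ↦ by_contra fun hζ1 ↦ not_noZeta_of_pow_prime_eq_one p hp2 hϖ hA hpA hζ hζ1 hNZ,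
    noZeta_of_forall_pow_prime_eq_one p hp2 hϖ hA hpA⟩

/-- **The boundary ball under «no `ζ_p`»** (`p` odd, `e = A·(p−1)`, `p ∤ A`), through the criterion: part IV's
`closedBall_pow_subset_logUnits_of_level` read with abc-iut-c312-3's hypothesis — the two parallel landings agree.
[cite: Washington1997, §5.1] -/
theorem closedBall_pow_subset_logUnits_of_forall_pow_prime_eq_one (hp2 : p ≠ 2) {ϖ : Kˣ} (hϖ : IsUniformizer ϖ) {A : ℕ}
    (hA : absRamificationIdx p K = A * (p - 1)) (hpA : ¬ p ∣ A) (hμ : ∀ ζ : K, ζ ^ p = 1 → ζ = 1) :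
    closedBall (0 : K) (‖(ϖ : K)‖ ^ A) ⊆ logUnits K :=
  closedBall_pow_subset_logUnits_of_level p hp2 (noZeta_of_forall_pow_prime_eq_one p hp2 hϖ hA hpA hμ) hϖ
    (LogEnvelope.one_le_level p hA) hA

end ValuationProfile

end Literature.IUT.LogVolume

end
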